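import Literature.AlgebraicGeometry.Resolution.ResolutionOfSingularities
import Mathlib.AlgebraicGeometry.Properties
import Mathlib.RingTheory.MvPolynomial.Basic
import Mathlib.RingTheory.Ideal.Quotient.Basic
import Mathlib.FieldTheory.Perfect
import HarnessLib

/-!
# Effective resolution and resolution in large characteristic (named fact)

Topic `Literature/AlgebraicGeometry/Resolution`. Named fact (sorry-free `def … : Prop`, users take
`(h : BierstoneGrigorievMilmanWlodarczyk2011)`) for the route
`ResolutionOfSingularities/UniformComplexity` (items `transfer_large_p`, `uniform_thesis`).

## Source

Bierstone–Grigoriev–Milman–Włodarczyk, *Effective Hironaka resolution and its complexity (with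
appendix on applications in positive characteristic)*, Asian J. Math. 15 (2011) 193–228
(arXiv:1206.3090), §7, Corollary 7.0.6 (p. 28):

"Assume the base field is perfect of characteristic `p`. There exists a function
`M(d, n, l) := M(n, d, n, l, 1) ∈ E^{n+3}` (independent of characteristic) such that for all
`Y ⊂ A^n` described by `l` polynomials of degree less than `n` [sc. at most `d`], for which
`M(d, n, l) < p`, there is a canonical (embedded) resolution of singularities."

(Theorem 7.0.4/7.0.5: the characteristic-zero canonical Hironaka algorithm for marked ideals runs
unchanged whenever the maximal multiplicity `M̄(X, I, E, μ)` of the marked ideals it produces is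
`< p`; Lemma 7.0.3(1) bounds `M̄` by the Grzegorczyk-class-`E^{n+3}` function `M(d, n, l)` of the
degree, embedding dimension and number of equations; Theorem 6.4.1: overall complexity in `E^{m+3}`.)

## What is vendored

The NON-EMBEDDED, weak consequence for INTEGRAL affine `Y`: an embedded resolution of the reduced
closed subvariety `Y ⊂ A^n_k` yields a proper birational morphism from a regular scheme onto `Y`
(BGMW §1, (2) ⇒ (3), p. 5), i.e. `Scheme.HasResolution Y` in the sense of
`ResolutionOfSingularities.lean`. We restrict to integral `Y` (for which "birational" in the sense
`IsBirational` of that file is unambiguous) — WEAKER than printed, hence safe as a hypothesis. The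
threshold function is existentially quantified (`∃ M : ℕ → ℕ → ℕ → ℕ`); its membership in `E^{n+3}`
is not transcribed. `Y` is presented as `Spec (k[x_1,…,x_n] ⧸ (S))` for a finite set `S` of at
most `l` polynomials of total degree at most `d`.

Consequence for the route: `transfer_large_p` (resolution of bounded-degree affine/projective
varieties in all characteristics `p > p₀(n, d, l)`) is KNOWN with an explicit (primitive-recursive
level `E^{n+3}`) `p₀`, independently of the model-theoretic transfer from `Hironaka1964` (which
gives no bound). Mathlib has the transfer principle itself:
`FirstOrder.Field.ACF_zero_realize_iff_finite_ACF_prime_not_realize`,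
`FirstOrder.Field.finite_ACF_prime_not_realize_of_ACF_zero_realize`, `ACF_isComplete`
(`Mathlib.ModelTheory.Algebra.Field.IsAlgClosed`).
-/

noncomputable section

open CategoryTheory AlgebraicGeometry

namespace Literature.AlgebraicGeometry.Resolution

/-- The affine `k`-scheme cut out by a finite set `S ⊆ k[x_1, …, x_n]` of polynomials:
`Spec (k[x_1,…,x_n] ⧸ (S))`. [folklore] -/
def affineZeroLocus (k : Type) [Field k] (n : ℕ) (S : Finset (MvPolynomial (Fin n) k)) :
    Scheme.{0} :=
  Spec (CommRingCat.of (MvPolynomial (Fin n) k ⧸ Ideal.span (S : Set (MvPolynomial (Fin n) k))))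

/-- **Bierstone–Grigoriev–Milman–Włodarczyk 2011, Corollary 7.0.6 (weak, non-embedded form for
integral affine varieties).** There is a function `M(d, n, l)` (independent of the characteristic;
in Grzegorczyk's class `E^{n+3}`, not transcribed) such that for every prime `p`, every perfect
field `k` of characteristic `p`, and every finite set `S` of at most `l` polynomials of total
degree at most `d` in `n` variables over `k` whose zero scheme `Y = Spec (k[x]/(S)) ⊆ A^n_k` is
integral: if `M(d, n, l) < p` then `Y` admits a resolution of singularities (a proper birational
morphism from a regular scheme; printed: "a canonical (embedded) resolution of singularities",
which yields the non-embedded one by BGMW §1 (2) ⇒ (3)).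
[cite: BierstoneGrigorievMilmanWlodarczyk2011, Cor. 7.0.6] -/
def BierstoneGrigorievMilmanWlodarczyk2011 : Prop :=
  ∃ M : ℕ → ℕ → ℕ → ℕ,
    ∀ (p : ℕ), p.Prime →
      ∀ (k : Type) [Field k] [CharP k p] [PerfectField k] (n d l : ℕ)
        (S : Finset (MvPolynomial (Fin n) k)),
        S.card ≤ l → (∀ f ∈ S, f.totalDegree ≤ d) → M d n l < p →
          IsIntegral (affineZeroLocus k n S) →
            Scheme.HasResolution (affineZeroLocus k n S)

end Literature.AlgebraicGeometry.Resolution
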